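import Literature.NumberTheory.Irrationality.Zudilin2014.FirstTaleScaling

/-!
# Zudilin 2014, first tale: the polynomial identity behind (P1) and the Newton expansion (P3)

[Zudilin2014ZetaTwo] W. Zudilin, *Two hypergeometric tales and a new irrationality measure of ζ(2)*,
Ann. Math. Qué. 38 (2014), arXiv:1310.1526, Section 3.

For admissible parameters `a b : Fin 4 → ℤ` (`FirstTale.Admissible`):
* `Pi_mul_num_eq` — eq. (P1) as an identity of POLYNOMIALS over `ℚ`:
  `Π(a,b)·num = P·den + Σ_{k=a₄}^{b₄−1} C_k · ∏_{i ≠ k} (X + i)` (from `R_eq_polyP_add_polar_full` at infinitely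
  many points);
* `natDegree_polyP_le` — `deg P ≤ d = Σa − Σb` [cite: Zudilin2014ZetaTwo, Section 3, after eq. (P1): "P(t) is a
  polynomial of degree at most d"];
* `newtonP ℓ = (X−1)(X−2)⋯(X−ℓ)/ℓ!` (the polynomials `P_ℓ(t)` of Lemma 1) and **`polyP_newton`** — eq. (P3):
  `P(t − a₂*) = Σ_{ℓ=0}^{d} A_ℓ(a,b) P_ℓ(t)` with the Newton coefficients `A_ℓ = coefA a b ℓ`
  (`= Σ_i (−1)^{ℓ−i} binom(ℓ,i) P(1+i−a₂*)`, Mathlib's Gregory–Newton formula `shift_eq_sum_fwdDiff_iter` at the nodes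
  `t = 1, …, d+1` and equality of polynomials of degree `≤ d` agreeing at `d+1` points).
Pure algebra over `ℚ[X]`; used by the cell's complex-analytic line representation of `r_n = q_n ζ(2) − p_n`
(pub-zeta5, fam-denom `Denom/TwoTaleP15Decay.LineRep`).  HONEST FRAMING: systematic search; no irrationality claim
unless certified.
-/

noncomputable section

open Polynomial Finset

namespace Literature.NumberTheory.Irrationality.Zudilin2014

variable {a b : Fin 4 → ℤ}

/-! ### Eq. (P1) as a polynomial identity -/

/-- `den` with the factor `X + k` removed: `∏_{i ∈ [a₄,b₄), i ≠ k} (X + i)`.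
[cite: Zudilin2014ZetaTwo, Section 3, eq. (P1)] -/
def denErase (a b : Fin 4 → ℤ) (k : ℤ) : ℚ[X] := ∏ i ∈ (Ico (a 3) (b 3)).erase k, (X + C (i : ℚ))

/-- `den = (X + k) · denErase k` for `k` in the pole range. [cite: Zudilin2014ZetaTwo, Section 3, eq. (P1)] -/
theorem den_eq_mul_denErase {k : ℤ} (hk : k ∈ Ico (a 3) (b 3)) :
    den a b = (X + C (k : ℚ)) * denErase a b k := by
  unfold den block denErase
  exact (mul_prod_erase (Ico (a 3) (b 3)) (fun i : ℤ => X + C (i : ℚ)) hk).symm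

/-- Evaluation of `denErase`. [cite: Zudilin2014ZetaTwo, Section 3, eq. (P1)] -/
theorem eval_denErase (k : ℤ) (t : ℚ) : (denErase a b k).eval t = ∏ i ∈ (Ico (a 3) (b 3)).erase k, (t + i) := by
  unfold denErase; rw [eval_prod]; simp

/-- **Eq. (P1) as an identity in `ℚ[X]`**: `Π·num = P·den + Σ_k C_k·∏_{i≠k}(X+i)`.
[cite: Zudilin2014ZetaTwo, Section 3, eq. (P1)–(P2)] -/
theorem Pi_mul_num_eq (h : Admissible a b) :
    C (Pi a b) * num a b = polyP a b * den a b + ∑ k ∈ Ico (a 3) (b 3), C (coefC a b k) * denErase a b k := by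
  apply Polynomial.eq_of_infinite_eval_eq
  have hfin : (((Ico (a 3) (b 3)).image fun k : ℤ => -(k : ℚ)) : Set ℚ).Finite := Finset.finite_toSet _
  refine (hfin.infinite_compl).mono fun t ht => ?_
  have ht' : ∀ k ∈ Ico (a 3) (b 3), t + k ≠ 0 := by
    intro k hk hzero
    exact ht (by
      rw [Finset.mem_coe, mem_image]
      exact ⟨k, hk, by linarith⟩)
  have hden : (den a b).eval t ≠ 0 := by
    unfold den
    exact eval_block_ne_zero fun i hi hti => ht' i hi (by rw [hti]; ring)
  have hR := R_eq_polyP_add_polar_full h ht'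
  unfold R at hR
  rw [div_eq_iff hden] at hR
  simp only [Set.mem_setOf_eq, eval_mul, eval_C, eval_add, eval_finsetSum]
  rw [hR, add_mul, sum_mul]
  congr 1
  refine sum_congr rfl fun k hk => ?_
  rw [den_eq_mul_denErase hk, eval_mul, eval_add, eval_X, eval_C]
  field_simp [ht' k hk]

/-! ### The degree of `P` -/

/-- `natDegree num = Σ_{j≤3} (a_j − b_j)`. [cite: Zudilin2014ZetaTwo, Section 3, eq. (gc)] -/
theorem natDegree_num (a b : Fin 4 → ℤ) :
    (num a b).natDegree = (a 0 - b 0).toNat + (a 1 - b 1).toNat + (a 2 - b 2).toNat := by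
  unfold num
  rw [natDegree_mul (mul_ne_zero (block_ne_zero _ _) (block_ne_zero _ _)) (block_ne_zero _ _),
    natDegree_mul (block_ne_zero _ _) (block_ne_zero _ _), natDegree_block, natDegree_block, natDegree_block]

/-- `natDegree (denErase k) ≤ b₄ − a₄ − 1` for `k` in the range. [cite: Zudilin2014ZetaTwo, Section 3, eq. (P1)] -/
theorem natDegree_denErase_le {k : ℤ} (hk : k ∈ Ico (a 3) (b 3)) :
    (denErase a b k).natDegree ≤ (b 3 - a 3).toNat - 1 := by
  unfold denErase
  refine (natDegree_prod_le _ _).trans ?_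
  simp_rw [natDegree_X_add_C]
  rw [sum_const, smul_eq_mul, mul_one, card_erase_of_mem hk, Int.card_Ico]

/-- **`deg P ≤ d`** [cite: Zudilin2014ZetaTwo, Section 3 (P is a polynomial of degree at most d)]. -/
theorem natDegree_polyP_le (h : Admissible a b) : (polyP a b).natDegree ≤ dExp a b := by
  by_cases hP : polyP a b = 0
  · rw [hP, natDegree_zero]; exact Nat.zero_le _
  have hid := Pi_mul_num_eq h
  have hdeg : (polyP a b * den a b).natDegree = (polyP a b).natDegree + (b 3 - a 3).toNat := by
    rw [natDegree_mul hP (monic_den a b).ne_zero]; unfold den; rw [natDegree_block]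
  have hPd : polyP a b * den a b = C (Pi a b) * num a b - ∑ k ∈ Ico (a 3) (b 3), C (coefC a b k) * denErase a b k := by
    rw [hid]; ring
  have h1 : (C (Pi a b) * num a b).natDegree ≤ (a 0 - b 0).toNat + (a 1 - b 1).toNat + (a 2 - b 2).toNat :=
    (natDegree_C_mul_le _ _).trans (natDegree_num a b).le
  have h2 : (∑ k ∈ Ico (a 3) (b 3), C (coefC a b k) * denErase a b k).natDegree ≤ (b 3 - a 3).toNat - 1 :=
    natDegree_sum_le_of_forall_le _ _ fun k hk => (natDegree_C_mul_le _ _).trans (natDegree_denErase_le hk)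
  have h3 := (natDegree_sub_le _ _).trans (max_le_max h1 h2)
  rw [← hPd, hdeg] at h3
  have hbal := h.balance
  simp only [Fin.sum_univ_four] at hbal
  have hu := h.upper 3
  have l0 := h.lower 0 (by decide) 0
  have l1 := h.lower 1 (by decide) 1
  have l2 := h.lower 2 (by decide) 2
  unfold dExp
  simp only [Fin.sum_univ_four]
  omega

/-! ### The Newton basis and eq. (P3) -/

/-- **`P_ℓ(X) = (X−1)(X−2)⋯(X−ℓ)/ℓ!`** [cite: Zudilin2014ZetaTwo, Lemma 1 (the polynomials P_ℓ)]. -/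
def newtonP (ℓ : ℕ) : ℚ[X] := C ((ℓ.factorial : ℚ)⁻¹) * (descPochhammer ℚ ℓ).comp (X - C 1)

/-- `P_ℓ(1 + m) = binom(m, ℓ)` at natural `m`. [cite: Zudilin2014ZetaTwo, Lemma 1] -/
theorem eval_newtonP_one_add (ℓ m : ℕ) : (newtonP ℓ).eval (1 + (m : ℚ)) = (m.choose ℓ : ℚ) := by
  unfold newtonP
  rw [eval_mul, eval_C, eval_comp, eval_sub, eval_X, eval_C, add_sub_cancel_left,
    descPochhammer_eval_eq_descFactorial, Nat.descFactorial_eq_factorial_mul_choose]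
  have hf : (ℓ.factorial : ℚ) ≠ 0 := by exact_mod_cast (Nat.factorial_pos ℓ).ne'
  push_cast
  field_simp

/-- `P_ℓ(t) = (∏_{j<ℓ} (t − 1 − j))/ℓ!`. [cite: Zudilin2014ZetaTwo, Lemma 1] -/
theorem eval_newtonP (ℓ : ℕ) (t : ℚ) :
    (newtonP ℓ).eval t = (∏ j ∈ range ℓ, (t - 1 - j)) / (ℓ.factorial : ℚ) := by
  unfold newtonP
  rw [eval_mul, eval_C, eval_comp, eval_sub, eval_X, eval_C, descPochhammer_eval_eq_prod_range]
  ring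

/-- `deg P_ℓ = ℓ`. [cite: Zudilin2014ZetaTwo, Lemma 1] -/
theorem natDegree_newtonP (ℓ : ℕ) : (newtonP ℓ).natDegree = ℓ := by
  unfold newtonP
  have hf : ((ℓ.factorial : ℚ)⁻¹) ≠ 0 := inv_ne_zero (by exact_mod_cast (Nat.factorial_pos ℓ).ne')
  rw [natDegree_C_mul hf, natDegree_comp, descPochhammer_natDegree, natDegree_X_sub_C, mul_one]

/-- The Newton coefficient `A_ℓ` is the `ℓ`-th forward difference of `t ↦ P(t − a₂*)` at `t = 1`.
[cite: Zudilin2014ZetaTwo, Section 3, eq. (P3)] -/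
theorem coefA_eq_fwdDiff (ℓ : ℕ) :
    coefA a b ℓ = (fwdDiff 1)^[ℓ] (fun t : ℚ => (polyP a b).eval (t - a2star a)) 1 := by
  rw [fwdDiff_iter_eq_sum_shift, coefA]
  refine sum_congr rfl fun i _ => ?_
  rw [zsmul_eq_mul, nsmul_eq_mul, mul_one]
  push_cast
  ring

/-- **Eq. (P3): the Newton interpolation of `P` at the nodes `1 − a₂*, 2 − a₂*, …`**:
`P(X − a₂*) = Σ_{ℓ=0}^{d} A_ℓ(a,b) · P_ℓ(X)` in `ℚ[X]`. [cite: Zudilin2014ZetaTwo, Section 3, eq. (P3)] -/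
theorem polyP_newton (h : Admissible a b) :
    (polyP a b).comp (X - C (a2star a : ℚ)) = ∑ ℓ ∈ range (dExp a b + 1), C (coefA a b ℓ) * newtonP ℓ := by
  set d := dExp a b with hd
  have hdegP := natDegree_polyP_le h
  -- the node set {1, 2, …, d+1}
  set s : Finset ℚ := (range (d + 1)).image fun m : ℕ => 1 + (m : ℚ) with hs
  have hcard : s.card = d + 1 := by
    rw [hs, card_image_of_injective _ fun x y hxy => by simpa using hxy, card_range]
  apply Polynomial.eq_of_degrees_lt_of_eval_finset_eq s
  · rw [hcard]
    refine (degree_le_natDegree.trans_lt ?_)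
    have : ((polyP a b).comp (X - C (a2star a : ℚ))).natDegree ≤ d := by
      rw [natDegree_comp, natDegree_X_sub_C, mul_one]; exact hdegP
    exact_mod_cast Nat.lt_succ_of_le this
  · rw [hcard]
    refine (degree_le_natDegree.trans_lt ?_)
    have : (∑ ℓ ∈ range (d + 1), C (coefA a b ℓ) * newtonP ℓ).natDegree ≤ d :=
      natDegree_sum_le_of_forall_le _ _ fun ℓ hℓ =>
        (natDegree_C_mul_le _ _).trans (by rw [natDegree_newtonP]; exact Nat.le_of_lt_succ (mem_range.1 hℓ))
    exact_mod_cast Nat.lt_succ_of_le this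
  · intro x hx
    rw [hs, mem_image] at hx
    obtain ⟨m, hm, rfl⟩ := hx
    rw [mem_range] at hm
    -- left: Gregory–Newton at t = 1 + m
    have hGN := shift_eq_sum_fwdDiff_iter (h := (1 : ℚ)) (fun t : ℚ => (polyP a b).eval (t - a2star a)) m 1
    simp only [nsmul_eq_mul, mul_one] at hGN
    rw [eval_comp, eval_sub, eval_X, eval_C, hGN, eval_finsetSum]
    -- right: Σ_{ℓ ≤ d} A_ℓ binom(m, ℓ); terms with ℓ > m vanish
    simp_rw [eval_mul, eval_C, eval_newtonP_one_add, coefA_eq_fwdDiff]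
    have hsub : range (m + 1) ⊆ range (d + 1) := range_subset_range.2 (by omega)
    rw [← sum_subset hsub fun ℓ hℓ hℓ' => by
      rw [mem_range] at hℓ hℓ'
      rw [Nat.choose_eq_zero_of_lt (by omega), Nat.cast_zero, mul_zero]]
    refine sum_congr rfl fun ℓ _ => ?_
    ring

end Literature.NumberTheory.Irrationality.Zudilin2014

end
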